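import Summits.Ventures.Crystal3D.Bulk.HexPerimeterDefs
import Summits.Ventures.Crystal3D.Bulk.SphSegmentCap
import HarnessLib

/-!
# Path sums and the perimeter split used by the main metric theorem of (d3)

HONEST FRAMING. Part of the venture `Summits/Ventures/Crystal3D` (cell `pub-crystal3d`, phase 2;
seat typer-bulk-2), generic bookkeeping; nothing here mentions GAP(1.26).

* `pathSeq A g L B` (defined in `Bulk/HexPerimeterDefs.lean`) — the sequence
  `A, g 1, …, g L, B, B, …`; `sum_pathSeq` evaluates
  `Σ_{t < L+1} ∠(f t, f (t+1)) = ∠(A, g 1) + Σ_{t ∈ Ico 1 L} ∠(g t, g (t+1)) + ∠(g L, B)`;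
* `polyPerim_split` — for `1 ≤ j₀ < m`:
  `polyPerim u m = ℓ 0 + Σ_{Ico 1 j₀} ℓ + ℓ j₀ + Σ_{Ico (j₀+1) m} ℓ` (`ℓ j = ∠(u j, u (j+1))`).
-/

noncomputable section

namespace Summit.Ventures.Crystal3D

open Literature.Geometry.DiscreteGeometry Real InnerProductGeometry Finset
open scoped InnerProductSpace RealInnerProductSpace

/-- The path starts at `A`. -/
theorem pathSeq_zero (A : EuclideanSpace ℝ (Fin 3)) (g : ℕ → EuclideanSpace ℝ (Fin 3)) (L : ℕ)
    (B : EuclideanSpace ℝ (Fin 3)) : pathSeq A g L B 0 = A := by simp [pathSeq]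

/-- The middle vertices of the path are `g 1, …, g L`. -/
theorem pathSeq_mid (A : EuclideanSpace ℝ (Fin 3)) (g : ℕ → EuclideanSpace ℝ (Fin 3)) (L : ℕ)
    (B : EuclideanSpace ℝ (Fin 3)) {t : ℕ} (h1 : 1 ≤ t) (h2 : t ≤ L) : pathSeq A g L B t = g t := by
  unfold pathSeq; rw [if_neg (by omega), if_pos h2]

/-- The path ends at `B`. -/
theorem pathSeq_last (A : EuclideanSpace ℝ (Fin 3)) (g : ℕ → EuclideanSpace ℝ (Fin 3)) (L : ℕ)
    (B : EuclideanSpace ℝ (Fin 3)) : pathSeq A g L B (L + 1) = B := by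
  unfold pathSeq; rw [if_neg (by omega), if_neg (by omega)]

/-- **Evaluation of the path sum.** -/
theorem sum_pathSeq (A : EuclideanSpace ℝ (Fin 3)) (g : ℕ → EuclideanSpace ℝ (Fin 3)) {L : ℕ}
    (hL : 1 ≤ L) (B : EuclideanSpace ℝ (Fin 3)) :
    ∑ t ∈ range (L + 1), angle (pathSeq A g L B t) (pathSeq A g L B (t + 1)) =
      angle A (g 1) + ∑ t ∈ Ico 1 L, angle (g t) (g (t + 1)) + angle (g L) B := by
  rw [Finset.sum_range_succ, ← Finset.sum_range_add_sum_Ico _ hL, Finset.sum_range_one,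
    pathSeq_zero, pathSeq_mid A g L B le_rfl hL, pathSeq_mid A g L B hL le_rfl, pathSeq_last]
  congr 1; congr 1
  apply Finset.sum_congr rfl
  intro t ht; rw [mem_Ico] at ht
  rw [pathSeq_mid A g L B ht.1 ht.2.le, pathSeq_mid A g L B (by omega) (by omega)]

/-- **Splitting a perimeter at two edges** `0` and `j₀` (`1 ≤ j₀ < m`). -/
theorem polyPerim_split (u : ℕ → EuclideanSpace ℝ (Fin 3)) {m j₀ : ℕ} (h1 : 1 ≤ j₀) (h2 : j₀ < m) :
    polyPerim u m = angle (u 0) (u 1) + ∑ j ∈ Ico 1 j₀, angle (u j) (u (j + 1)) +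
      angle (u j₀) (u (j₀ + 1)) + ∑ j ∈ Ico (j₀ + 1) m, angle (u j) (u (j + 1)) := by
  unfold polyPerim
  rw [← Nat.Ico_zero_eq_range, ← Finset.sum_Ico_consecutive _ (Nat.zero_le j₀) h2.le,
    Finset.sum_eq_sum_Ico_succ_bot (by omega : 0 < j₀), Finset.sum_eq_sum_Ico_succ_bot h2]
  ring

/-- A vertex of a window-convex polygon is nonzero. -/
theorem ne_zero_of_convex {m : ℕ} {u : ℕ → EuclideanSpace ℝ (Fin 3)}
    (hcx : ∀ i j k, i < j → j < k → k < i + m → 0 < orient3 (u i) (u j) (u k)) (hm : 3 ≤ m)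
    (t : ℕ) : u t ≠ 0 := by
  intro h
  have := hcx t (t + 1) (t + 2) (by omega) (by omega) (by omega)
  rw [h] at this
  simp [orient3] at this

/-- A unit vector is nonzero. -/
theorem ne_zero_of_norm_one {x : EuclideanSpace ℝ (Fin 3)} (h : ‖x‖ = 1) : x ≠ 0 := by
  rw [← norm_ne_zero_iff, h]; norm_num

/-- The unit normal of an edge whose plane is at height `≥ s` over `z` (cap property) — packaged
for `path_bound`. -/
theorem edge_normal_of_cap {a b z : EuclideanSpace ℝ (Fin 3)} {s : ℝ} (hab : cross3 a b ≠ 0)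
    (hcap : s * ‖cross3 a b‖ ≤ orient3 a b z) :
    ∃ u : EuclideanSpace ℝ (Fin 3), ‖u‖ = 1 ∧ s ≤ ⟪z, u⟫ ∧ ⟪a, u⟫ = 0 ∧ ⟪b, u⟫ = 0 := by
  have hpos : 0 < ‖cross3 a b‖ := norm_pos_iff.2 hab
  refine ⟨‖cross3 a b‖⁻¹ • cross3 a b, ?_, ?_, ?_, ?_⟩
  · rw [norm_smul, norm_inv, norm_norm, inv_mul_cancel₀ hpos.ne']
  · rw [real_inner_smul_right, inner_cross3_right]
    rw [le_inv_mul_iff₀ hpos]; linarith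
  · rw [real_inner_smul_right, inner_cross3_right, orient3_self_outer, mul_zero]
  · rw [real_inner_smul_right, inner_cross3_right, orient3_self_right, mul_zero]

end Summit.Ventures.Crystal3D

end
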